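import Mathlib
import HarnessLib
import Summits.FinalStateConjecture.Statement

/-!
# Route ClusterCompleteness — the Assembly, frame form (item stmt-FinalStateConjecture-14677)

The assembly item of route `ClusterCompleteness` (rev ≥ 17) for the Final State Conjecture:

`AdiabaticMultiKerrILED → LinearToNonlinearCapture → OmegaLimitMultiKerr → FinalStateConjecture`,

literally the type of the route file's deciding theorem
`Summit.FinalStateConjecture.FinalStateConjecture.Theses.ClusterCompleteness.closes`.

Design constraint (why this file does NOT import the route module
`Summits.FinalStateConjecture.FinalStateConjecture.Theses.ClusterCompleteness`): when the item closes,
the gate re-renders the route file with `import <closing module>` and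
`theorem Assembly_holds : Assembly := …`; a closing module that itself imports the route module makes
that render an import cycle (the rev-3/4 episodes of routes `EIHFluxBalance` and `PhotonSphereChannels`).
So the theorem below is stated with the three crux statements INLINED VERBATIM — the bodies of
`AdiabaticMultiKerrILED`, `LinearToNonlinearCapture` (`:= AdiabaticMultiKerrILED →
RecurrentMultiKerrCapture`, both bodies inlined) and `OmegaLimitMultiKerr`, copied from the route file
rev 20 under the same `open` context — so that its type is definitionally (by `δ`-unfolding only) the
route decl `Assembly`, and the route file can import this module without a cycle (pattern of
`Theorems/EIHFluxBalanceAssemblyFrame.lean`, `Theorems/PhotonSphereChannelsAssemblyFrame.lean`).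

The proof is pure logic, the body of `closes`: obtain the order `k` from
`X := LinearToNonlinearCapture AdiabaticMultiKerrILED` (= `RecurrentMultiKerrCapture`);
`OmegaLimitMultiKerr k` says that "(∃ MGHD) ∧ ∀ MGHD, ¬Settles → Recursₖ" is Christodoulou-generic in
the admissible class; `X` makes "¬Settles ∧ Recursₖ" contradictory for every MGHD of an admissible
datum; and Christodoulou genericity in curve form `IsChristodoulouGeneric 𝓓 P 1` is monotone in the
property `P` on `𝓓` (the exceptional set only shrinks, and the same smooth injective admissible
one-parameter family through an exceptional datum works). No analysis, no new definitions.

## Re-type T2 (2026-08-16) — the repaired frame `ClusterCompleteness.assemblyT2_frame_proof`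

On 2026-08-16 the summit statement `FinalStateConjecture` was RE-TYPED (statement-revised p126844,
re-type T2): genericity is now the TAME notion `InitialDataSet.IsTameChristodoulouGeneric` (one fixed
end `e : AFEnd X`, a tame immersed one-parameter family), and the post-maximality conclusion gained
the clauses `Summit.FinalStateConjecture.RaysStayInClosure 𝒟.toCauchyDevelopment O` and
`Summit.FinalStateConjecture.IsFutureOriented d`. Route-repair rev 21 (2026-08-16T23:24:55Z) restated
the target `RecurrentMultiKerrCapture` (stmt-FinalStateConjecture-17637: anchored + oriented interface,
re-typed settle matrix), `RecurrentlyFlatDisperses` and `OmegaLimitMultiKerr`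
(stmt-FinalStateConjecture-17639: tame Christodoulou genericity of the re-typed dichotomy), keeping
`AdiabaticMultiKerrILED`, `LinearToNonlinearCapture := AdiabaticMultiKerrILED →
RecurrentMultiKerrCapture` and `Assembly` (stmt-FinalStateConjecture-14677) textually unchanged — so the
MEANING of `Assembly` followed the restated decls while the rev-17/20 frame theorem
`ClusterCompleteness.assembly_frame_proof` of this file (old bodies `→ FinalStateConjecture`) stopped
elaborating (full build 2026-08-17: settle-matrix mismatch at `hp.2 𝒟 hmax hS`, family type
`EuclideanSpace ℝ (Fin 1) → InitialDataSet (𝓡 3) X` vs the tame witness). The theorem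
`ClusterCompleteness.assemblyT2_frame_proof` below states the three CURRENT hypotheses inlined
verbatim (bodies of `AdiabaticMultiKerrILED`, of `LinearToNonlinearCapture` with both constituents
inlined, and of `OmegaLimitMultiKerr`, copied mechanically from the route file rev 21, one physical
line each), so that its type is again the route decl `…Theses.ClusterCompleteness.Assembly`
(stmt-FinalStateConjecture-14677) by `δ`-unfolding alone, under the same Theses-free design
constraint as above; its proof is the body of the route's rev-21 deciding theorem `closes`, verbatim
(the tame family `⟨e, F, …⟩` produced by `OmegaLimitMultiKerr k` for the exceptional datum is reused
as is). The old name survives as a deprecated alias (Theorems files are append-only).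
-/

-- every `Summit.FinalStateConjecture.FinalStateConjecture.…` name repeats the summit = sub-problem
-- segment (D-0017 layout, CONVENTIONS §2; lakefile sets it for the library build, a standalone
-- elaboration of this file does not see that option); the duplicate is deliberate.
set_option linter.dupNamespace false

namespace Summit.FinalStateConjecture.FinalStateConjecture.Theorems

open scoped BigOperators Topology Manifold Classical MeasureTheory ProbabilityTheory Matrix InnerProductSpace ComplexConjugate ContinuousMap ContDiff
open Filter Set Function TopologicalSpace MeasureTheory

open Literature.Geometry.Lorentzian

/-- **Assembly of route ClusterCompleteness, frame form, re-typed for the T2 summit statement**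
(item stmt-FinalStateConjecture-14677, rev-21 meaning):
`AdiabaticMultiKerrILED → LinearToNonlinearCapture → OmegaLimitMultiKerr → FinalStateConjecture`
with the three route decls written out verbatim (first binder: the Graf-glued multi-centred
energy-boundedness/ILED statement `AdiabaticMultiKerrILED` for scalar waves on strictly receding
tails-cut patched multi-Kerr backgrounds; second binder: `LinearToNonlinearCapture`, i.e. that
statement implies the anchored, ORIENTED recurrent multi-Kerr capture `RecurrentMultiKerrCapture`
(rev 21) — some order `k` such that every maximal vacuum Cauchy development of admissible data
carrying anchored, separating, exhaustive, future-oriented final-state-shaped late charts in which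
`Cᵏ` closeness to a sub-extremal multi-Kerr configuration recurs has complete `𝓘⁺` and settles down
in the re-typed sense of the Statement (rays stay in the closure of the settled region, exhaustive
charts, future-oriented chart times); third binder: `OmegaLimitMultiKerr` (rev 21), the generic
ω-limit dichotomy — for every order `k`, TAME-Christodoulou-generically in the admissible class an
MGHD exists and every MGHD that does not settle down recurs in exactly that sense), so that this
type unfolds to the route decl `Summit.FinalStateConjecture.FinalStateConjecture.Theses.ClusterCompleteness.Assembly`
by `δ`-reduction alone. Proof (the route's rev-21 deciding theorem `closes`): take `k` from the
capture statement obtained by applying the second hypothesis to the first; feed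
`OmegaLimitMultiKerr k` the datum, which is exceptional for its property because capture turns
"does not settle, hence recurs" into a contradiction for every MGHD; the resulting tame immersed
one-parameter family on its end works for the Statement's property by the same pointwise argument
along the curve. -/
theorem ClusterCompleteness.assemblyT2_frame_proof :
    (∀ N : ℕ, ∃ d₀ α v₀ : ℝ, 0 < d₀ ∧ 0 < α ∧ 0 < v₀ ∧ ∀ (M a : Fin N → ℝ) (Λ : Fin N → lorentzGroup) (p : Fin N → E3) (u : Fin N → E4) (q : Fin N → E4 → E4), (∀ i, u i = (Λ i : E4 ≃L[ℝ] E4) (E4.basisVector 0)) → (∀ i x, q i x = poincareInv (Λ i) (E4.ofTimeSpace 0 (p i)) x) → (∀ i, 0 < M i) → (∀ i, |a i| ≤ α * M i) → (∀ i, 0 < u i 0 ∧ ‖E4.spatial (u i)‖ ≤ v₀ * u i 0) → (∀ i j, i ≠ j → d₀ * (M i + M j) ≤ dist (p i) (p j) ∧ 0 < ⟪p i - p j, (u i 0)⁻¹ • E4.spatial (u i) - (u j 0)⁻¹ • E4.spatial (u j)⟫_ℝ) → ∀ (G : E4 → Fin 4 → Fin 4 → ℝ), (∀ x μ ν, G x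 μ ν = Minkowski.bilin (E4.basisVector μ) (E4.basisVector ν) - ∑ i, Real.smoothTransition (2 - Kerr.radius (a i) (q i x) / (8 * M i)) * (2 * Kerr.scalarH (M i) (a i) (q i x)) * ((Λ i : E4 ≃L[ℝ] E4) (Kerr.nullVector (a i) (q i x))) μ * ((Λ i : E4 ≃L[ℝ] E4) (Kerr.nullVector (a i) (q i x))) ν) → ∀ (E : (E4 → ℝ) → ℝ → ENNReal), (∀ φ t, E φ t = ∫⁻ y in {y : E3 | ∀ i, Kerr.rPlus (M i) (a i) < Kerr.radius (a i) (q i (E4.ofTimeSpace t y))}, ENNReal.ofReal (∑ μ : Fin 4, (fderiv ℝ φ (E4.ofTimeSpace t y) (E4.basisVector μ)) ^ 2)) → ∀ R : ℝ, ∃ C : NNReal, ∀ ψ : E4 → ℝ, ContDiff ℝ ∞ ψ → (∀ x : E4, 0 ≤ x 0 → (∀ i, Kerr.rPlus (M i) (a i) < Kerr.radius (a i) (q i x)) → ∑ μ : Fin 4, fderiv ℝ (fun y ↦ ∑ ν : Fin 4, G y μ ν * fderiv ℝ ψ y (E4.basisVector ν)) x (E4.basisVector μ) = 0) → (∀ t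 : ℝ, 0 ≤ t → E ψ t ≤ (C : ENNReal) * E ψ 0) ∧ ∫⁻ t in Set.Ioi (0 : ℝ), ∫⁻ y in {y : E3 | ‖y‖ ≤ R ∧ ∀ i, Kerr.rPlus (M i) (a i) < Kerr.radius (a i) (q i (E4.ofTimeSpace t y))}, ENNReal.ofReal (∑ μ : Fin 4, (fderiv ℝ ψ (E4.ofTimeSpace t y) (E4.basisVector μ)) ^ 2) ≤ (C : ENNReal) * (E ψ 0 + E (fun x ↦ fderiv ℝ ψ x (E4.basisVector 0)) 0)) →
    ((∀ N : ℕ, ∃ d₀ α v₀ : ℝ, 0 < d₀ ∧ 0 < α ∧ 0 < v₀ ∧ ∀ (M a : Fin N → ℝ) (Λ : Fin N → lorentzGroup) (p : Fin N → E3) (u : Fin N → E4) (q : Fin N → E4 → E4), (∀ i, u i = (Λ i : E4 ≃L[ℝ] E4) (E4.basisVector 0)) → (∀ i x, q i x = poincareInv (Λ i) (E4.ofTimeSpace 0 (p i)) x) → (∀ i, 0 < M i) → (∀ i, |a i| ≤ α * M i) → (∀ i, 0 < u i 0 ∧ ‖E4.spatial (u i)‖ ≤ v₀ * u i 0) → (∀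 i j, i ≠ j → d₀ * (M i + M j) ≤ dist (p i) (p j) ∧ 0 < ⟪p i - p j, (u i 0)⁻¹ • E4.spatial (u i) - (u j 0)⁻¹ • E4.spatial (u j)⟫_ℝ) → ∀ (G : E4 → Fin 4 → Fin 4 → ℝ), (∀ x μ ν, G x μ ν = Minkowski.bilin (E4.basisVector μ) (E4.basisVector ν) - ∑ i, Real.smoothTransition (2 - Kerr.radius (a i) (q i x) / (8 * M i)) * (2 * Kerr.scalarH (M i) (a i) (q i x)) * ((Λ i : E4 ≃L[ℝ] E4) (Kerr.nullVector (a i) (q i x))) μ * ((Λ i : E4 ≃L[ℝ] E4) (Kerr.nullVector (a i) (q i x))) ν) → ∀ (E : (E4 → ℝ) → ℝ → ENNReal), (∀ φ t, E φ t = ∫⁻ y in {y : E3 | ∀ i, Kerr.rPlus (M i) (a i) < Kerr.radius (a i) (q i (E4.ofTimeSpace t y))}, ENNReal.ofReal (∑ μ : Fin 4, (fderiv ℝ φ (E4.ofTimeSpace t y) (E4.basisVector μ)) ^ 2)) → ∀ R : ℝ, ∃ C : NNReal, ∀ ψ : E4 → ℝ, ContDiff ℝ ∞ ψ → (∀ x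 : E4, 0 ≤ x 0 → (∀ i, Kerr.rPlus (M i) (a i) < Kerr.radius (a i) (q i x)) → ∑ μ : Fin 4, fderiv ℝ (fun y ↦ ∑ ν : Fin 4, G y μ ν * fderiv ℝ ψ y (E4.basisVector ν)) x (E4.basisVector μ) = 0) → (∀ t : ℝ, 0 ≤ t → E ψ t ≤ (C : ENNReal) * E ψ 0) ∧ ∫⁻ t in Set.Ioi (0 : ℝ), ∫⁻ y in {y : E3 | ‖y‖ ≤ R ∧ ∀ i, Kerr.rPlus (M i) (a i) < Kerr.radius (a i) (q i (E4.ofTimeSpace t y))}, ENNReal.ofReal (∑ μ : Fin 4, (fderiv ℝ ψ (E4.ofTimeSpace t y) (E4.basisVector μ)) ^ 2) ≤ (C : ENNReal) * (E ψ 0 + E (fun x ↦ fderiv ℝ ψ x (E4.basisVector 0)) 0)) →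
      (open Literature.Geometry.Lorentzian in open scoped ContDiff in ∃ k : ℕ, ∀ (X : Type) [TopologicalSpace X] [ChartedSpace E3 X] [IsManifold (𝓡 3) ∞ X] [T2Space X] [SecondCountableTopology X] [ConnectedSpace X], ∀ D ∈ admissibleVacuumData X, ∀ 𝒟 : VacuumCauchyDevelopment D, 𝒟.IsMaximal → (∃ (O : Set 𝒟.carrier) (N : ℕ) (M a : Fin N → ℝ) (mo : Fin N → lorentzGroup × E4) (τ₀ : ℝ) (Ψ : ∀ i, boostedKerrExterior (mo i).1 (mo i).2 (M i) (a i) → 𝒟.carrier) (ρ R : Fin N → ℝ → ℝ) (U₀ : Opens E4) (Ψ₀ : U₀ → 𝒟.carrier), (∀ i, Kerr.IsSubextremal (M i) (a i)) ∧ (∀ i, 𝒟.toSpacetime.IsLateChart (boostedKerrBackground (mo i).1 (mo i).2 (M i) (a i)) O τ₀ (Ψ i)) ∧ 𝒟.toSpacetime.IsLateChart (Minkowski.backgroundOn U₀) O τ₀ Ψ₀ ∧ (∀ i, Tendsto (fun t ↦ ρ i t / t) atTop (𝓝 0)) ∧ (∀ i, Tendsto (R i) atTop atTop ∧ ∀ τ,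 max (Kerr.rPlus (M i) (a i)) 0 + 1 ≤ R i τ) ∧ {x : E4 | τ₀ < x 0 ∧ ∀ i, ρ i (x 0) < Kerr.radius (a i) (poincareInv (mo i).1 (mo i).2 x)} ⊆ (U₀ : Set E4) ∧ (∀ R' : ℝ, ∃ τ₁ : ℝ, Pairwise (Function.onFun Disjoint fun i ↦ Ψ i '' (boostedKerrBackground (mo i).1 (mo i).2 (M i) (a i)).truncLateRegion τ₁ R')) ∧ O = Summit.FinalStateConjecture.exteriorOf 𝒟.toCauchyDevelopment ((⋃ i, Ψ i '' (boostedKerrBackground (mo i).1 (mo i).2 (M i) (a i)).lateRegion τ₀) ∪ Ψ₀ '' (Minkowski.backgroundOn U₀).lateRegion τ₀) ∧ Summit.FinalStateConjecture.RaysStayInClosure 𝒟.toCauchyDevelopment O ∧ (∀ τ₁ : ℝ, τ₀ < τ₁ → O \ (Ψ₀ '' (Minkowski.backgroundOn U₀).lateRegion τ₁ ∪ ⋃ i, Ψ i '' {x | τ₁ < (boostedKerrBackground (mo i).1 (mo i).2 (M i) (a i)).time x.1 ∧ (boostedKerrBackground (mo i).1 (mo i).2 (M i) (a i)).radius x.1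 ≤ R i ((boostedKerrBackground (mo i).1 (mo i).2 (M i) (a i)).time x.1)}) ⊆ 𝒟.metric.causalPast 𝒟.timeOrientation (Ψ₀ '' (Minkowski.backgroundOn U₀).timeSlab τ₁ ∪ ⋃ i, Ψ i '' (boostedKerrBackground (mo i).1 (mo i).2 (M i) (a i)).truncTimeSlab (R i τ₁) τ₁)) ∧ ((∀ i, Summit.FinalStateConjecture.IsOrthochronous (mo i).1) ∧ ∀ τ : ℝ, τ₀ < τ → ∀ x ∈ (Minkowski.backgroundOn U₀).timeSlab τ, 𝒟.toSpacetime.timeOrientation.IsFutureDirected (mfderiv 𝓘(ℝ, E4) (𝓡 4) Ψ₀ x (E4.basisVector 0))) ∧ (∀ τ : ℝ, τ₀ < τ → 𝒟.toSpacetime.deviationCk (Minkowski.backgroundOn U₀) Ψ₀ 0 τ ≤ ENNReal.ofReal (1 / 4) ∧ ∀ i, 𝒟.toSpacetime.truncDeviationCk (boostedKerrBackground (mo i).1 (mo i).2 (M i) (a i)) (Ψ i) 0 (R i τ) τ ≤ ENNReal.ofReal (1 / 4)) ∧ ∀ R' : ℝ, ∀ ε : ℝ, 0 < ε → ∃ᶠ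 τ in atTop, 𝒟.toSpacetime.deviationCk (Minkowski.backgroundOn U₀) Ψ₀ k τ ≤ ENNReal.ofReal ε ∧ ∀ i, 𝒟.toSpacetime.truncDeviationCk (boostedKerrBackground (mo i).1 (mo i).2 (M i) (a i)) (Ψ i) k R' τ ≤ ENNReal.ofReal ε ∧ ∀ x ∈ (boostedKerrBackground (mo i).1 (mo i).2 (M i) (a i)).truncTimeSlab R' τ, 𝒟.toSpacetime.timeOrientation.IsFutureDirected (mfderiv 𝓘(ℝ, E4) (𝓡 4) (Ψ i) x (((mo i).1 : E4 ≃L[ℝ] E4) (Kerr.timeVector (M i) (a i) (poincareInv (mo i).1 (mo i).2 (x : E4)))))) → (Summit.FinalStateConjecture.HasCompleteNullInfinity 𝒟.toCauchyDevelopment ∧ ∃ (O : Set 𝒟.carrier) (d : FinalStateDecomposition 𝒟.toSpacetime O 2), (∀ i, Kerr.IsSubextremal (d.mass i) (d.spin i)) ∧ O = Summit.FinalStateConjecture.exteriorOf 𝒟.toCauchyDevelopment d.charted ∧ Summit.FinalStateConjecture.RaysStayInClosure 𝒟.toCauchyDevelopment O ∧ Summit.FinalStateConjecture.HasExhaustiveCharts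 d ∧ Summit.FinalStateConjecture.IsFutureOriented d))) →
    (open Literature.Geometry.Lorentzian in open scoped ContDiff in ∀ (k : ℕ) (X : Type) [TopologicalSpace X] [ChartedSpace E3 X] [IsManifold (𝓡 3) ∞ X] [T2Space X] [SecondCountableTopology X] [ConnectedSpace X], InitialDataSet.IsTameChristodoulouGeneric (admissibleVacuumData X) (fun D ↦ (∃ 𝒟 : VacuumCauchyDevelopment D, 𝒟.IsMaximal) ∧ ∀ 𝒟 : VacuumCauchyDevelopment D, 𝒟.IsMaximal → ¬ (Summit.FinalStateConjecture.HasCompleteNullInfinity 𝒟.toCauchyDevelopment ∧ ∃ (O : Set 𝒟.carrier) (d : FinalStateDecomposition 𝒟.toSpacetime O 2), (∀ i, Kerr.IsSubextremal (d.mass i) (d.spin i)) ∧ O = Summit.FinalStateConjecture.exteriorOf 𝒟.toCauchyDevelopment d.charted ∧ Summit.FinalStateConjecture.RaysStayInClosure 𝒟.toCauchyDevelopment O ∧ Summit.FinalStateConjecture.HasExhaustiveCharts d ∧ Summit.FinalStateConjecture.IsFutureOriented d) → ∃ (O : Set 𝒟.carrier) (N : ℕ) (M a : Fin N → ℝ)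 (mo : Fin N → lorentzGroup × E4) (τ₀ : ℝ) (Ψ : ∀ i, boostedKerrExterior (mo i).1 (mo i).2 (M i) (a i) → 𝒟.carrier) (ρ R : Fin N → ℝ → ℝ) (U₀ : Opens E4) (Ψ₀ : U₀ → 𝒟.carrier), (∀ i, Kerr.IsSubextremal (M i) (a i)) ∧ (∀ i, 𝒟.toSpacetime.IsLateChart (boostedKerrBackground (mo i).1 (mo i).2 (M i) (a i)) O τ₀ (Ψ i)) ∧ 𝒟.toSpacetime.IsLateChart (Minkowski.backgroundOn U₀) O τ₀ Ψ₀ ∧ (∀ i, Tendsto (fun t ↦ ρ i t / t) atTop (𝓝 0)) ∧ (∀ i, Tendsto (R i) atTop atTop ∧ ∀ τ, max (Kerr.rPlus (M i) (a i)) 0 + 1 ≤ R i τ) ∧ {x : E4 | τ₀ < x 0 ∧ ∀ i, ρ i (x 0) < Kerr.radius (a i) (poincareInv (mo i).1 (mo i).2 x)} ⊆ (U₀ : Set E4) ∧ (∀ R' : ℝ, ∃ τ₁ : ℝ, Pairwise (Function.onFun Disjoint fun i ↦ Ψ i '' (boostedKerrBackground (mo i).1 (mo i).2 (M i) (a i)).truncLateRegion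 τ₁ R')) ∧ O = Summit.FinalStateConjecture.exteriorOf 𝒟.toCauchyDevelopment ((⋃ i, Ψ i '' (boostedKerrBackground (mo i).1 (mo i).2 (M i) (a i)).lateRegion τ₀) ∪ Ψ₀ '' (Minkowski.backgroundOn U₀).lateRegion τ₀) ∧ Summit.FinalStateConjecture.RaysStayInClosure 𝒟.toCauchyDevelopment O ∧ (∀ τ₁ : ℝ, τ₀ < τ₁ → O \ (Ψ₀ '' (Minkowski.backgroundOn U₀).lateRegion τ₁ ∪ ⋃ i, Ψ i '' {x | τ₁ < (boostedKerrBackground (mo i).1 (mo i).2 (M i) (a i)).time x.1 ∧ (boostedKerrBackground (mo i).1 (mo i).2 (M i) (a i)).radius x.1 ≤ R i ((boostedKerrBackground (mo i).1 (mo i).2 (M i) (a i)).time x.1)}) ⊆ 𝒟.metric.causalPast 𝒟.timeOrientation (Ψ₀ '' (Minkowski.backgroundOn U₀).timeSlab τ₁ ∪ ⋃ i, Ψ i '' (boostedKerrBackground (mo i).1 (mo i).2 (M i) (a i)).truncTimeSlab (R i τ₁) τ₁)) ∧ ((∀ i, Summit.FinalStateConjecture.IsOrthochronous (mo i).1) ∧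 ∀ τ : ℝ, τ₀ < τ → ∀ x ∈ (Minkowski.backgroundOn U₀).timeSlab τ, 𝒟.toSpacetime.timeOrientation.IsFutureDirected (mfderiv 𝓘(ℝ, E4) (𝓡 4) Ψ₀ x (E4.basisVector 0))) ∧ (∀ τ : ℝ, τ₀ < τ → 𝒟.toSpacetime.deviationCk (Minkowski.backgroundOn U₀) Ψ₀ 0 τ ≤ ENNReal.ofReal (1 / 4) ∧ ∀ i, 𝒟.toSpacetime.truncDeviationCk (boostedKerrBackground (mo i).1 (mo i).2 (M i) (a i)) (Ψ i) 0 (R i τ) τ ≤ ENNReal.ofReal (1 / 4)) ∧ ∀ R' : ℝ, ∀ ε : ℝ, 0 < ε → ∃ᶠ τ in atTop, 𝒟.toSpacetime.deviationCk (Minkowski.backgroundOn U₀) Ψ₀ k τ ≤ ENNReal.ofReal ε ∧ ∀ i, 𝒟.toSpacetime.truncDeviationCk (boostedKerrBackground (mo i).1 (mo i).2 (M i) (a i)) (Ψ i) k R' τ ≤ ENNReal.ofReal ε ∧ ∀ x ∈ (boostedKerrBackground (mo i).1 (mo i).2 (M i) (a i)).truncTimeSlab R' τ, 𝒟.toSpacetime.timeOrientation.IsFutureDirected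 (mfderiv 𝓘(ℝ, E4) (𝓡 4) (Ψ i) x (((mo i).1 : E4 ≃L[ℝ] E4) (Kerr.timeVector (M i) (a i) (poincareInv (mo i).1 (mo i).2 (x : E4)))))) 1) →
    _root_.FinalStateConjecture := by
  intro h₂ h₃ h₉
  -- the order of closeness `k` of X = RecurrentMultiKerrCapture := h₃ h₂
  obtain ⟨k, hk⟩ := h₃ h₂
  intro X _ _ _ _ _ _ d hd
  -- the datum `d`, exceptional for the Statement's property, is exceptional for the dichotomy's
  -- property at order `k`: capture makes "¬ settles, hence recurs" absurd for every MGHD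
  obtain ⟨e, F, hF, hI, h0, hinj, hD, hE⟩ := h₉ k X d
    ⟨hd.1, fun hp ↦ hd.2 ⟨hp.1, fun 𝒟 hmax ↦ Classical.byContradiction fun hS ↦
      hS (hk X d hd.1 𝒟 hmax (hp.2 𝒟 hmax hS))⟩⟩
  -- the same tame immersed admissible family on the same end works: off the exceptional
  -- parameters the dichotomy's property upgrades pointwise to the Statement's property
  exact ⟨e, F, hF, hI, h0, hinj, hD, fun c hc hmem ↦
    hE c hc ⟨hmem.1, fun hp ↦ hmem.2 ⟨hp.1, fun 𝒟 hmax ↦ Classical.byContradiction fun hS ↦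
      hS (hk X _ hmem.1 𝒟 hmax (hp.2 𝒟 hmax hS))⟩⟩⟩

/-- Deprecated spelling: the rev-17/20 frame (old bodies of `RecurrentMultiKerrCapture` and
`OmegaLimitMultiKerr` inlined, `→ FinalStateConjecture`; the item's recorded `closed_by` name)
stopped elaborating when the summit statement was re-typed (T2, p126844: tame immersed genericity
families, 5-conjunct settle matrix) and the route restated those decls (rev 21); the repaired frame
for the same assembly item stmt-FinalStateConjecture-14677 is `ClusterCompleteness.assemblyT2_frame_proof`,
of which this is an alias (same type: the current `Assembly` by `δ`-unfolding). -/
@[deprecated ClusterCompleteness.assemblyT2_frame_proof (since := "2026-08-17")]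
alias ClusterCompleteness.assembly_frame_proof := ClusterCompleteness.assemblyT2_frame_proof

end Summit.FinalStateConjecture.FinalStateConjecture.Theorems
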